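import Summits.MatrixMultiplication.MatrixMultiplication.Theorems.ObstructionDescentPointLevelFormat
import Summits.MatrixMultiplication.MatrixMultiplication.Theorems.ObstructionDescentFormatTwoPassLevels
import Literature.Computability.AlgebraicComplexity.BI17FundamentalTensorInvariantProofs
import Literature.Computability.AlgebraicComplexity.BI17LatinCubeCountTwo

set_option linter.dupNamespace false
set_option autoImplicit false

/-!
# Obstruction descent — the base level of the (U)-input is BI 2017's fundamental invariant (decomp-mm · lens 3 · gen 30, def-free)

`route-MatrixMultiplication-ObstructionDescent`, crux `NoOccurrenceObstruction` (`P_O`, stmt 29040), invariant-tower slice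
(`tower_of_levels`, `tower_wall_of_unitLevels_self`): the tower at a cell `(n, m)` needs the input
(U_{n²}) "every even `e ≥ n` is a level of the point `⟨n²⟩ ∈ ℂ^{n²} ⊗ ℂ^{n²} ⊗ ℂ^{n²}`", which `unitLevels_self_of_prim` reduces
to the window `n ≤ e ≤ 2n` (`e < 2n` for even `n`).  This file identifies the BASE of that window with a named object of the
literature and certifies it at `n = 2`:

* Bürgisser–Ikenmeyer's fundamental invariant `F_n ∈ ℂ[ℂ^{n²} ⊗ ℂ^{n²} ⊗ ℂ^{n²}]_{n³}` (BI 2017 eq. (5.5), tree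
  `fundInvariantTensor`) is a weight vector of the cube type `((n^{n²}))³` in degree `n·n²` of THIS calculus
  (`fundInvariantTensor_mem_hwvSpace`: homogeneity + `F_n((A,B,C)·t) = (det A det B det C)^n F_n(t)`, BI 2017 Thm 5.13, with
  `det = ∏ diagonal` on the Borel subgroup);
* its value at the unit tensor is the signed Latin-cube count, `F_n(⟨n²⟩) = L(n)` (BI 2017 Prop. 5.22, tree
  `aeval_fundInvariantTensor_unitTensor`), so `L(n) ≠ 0` — BI 2017 Problem 5.23, open for even `n ≥ 6` — puts the base level
  `n ∈ E'_{n²}(⟨n²⟩)` (`mem_pointLevels_unitTensor_of_latinCubeCount_ne_zero`); for odd `n > 1`, `F_n(⟨n²⟩) = 0`;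
* `L(2) = 24` (tree `latinCubeCount_two`) gives, unconditionally, `2 ∈ E'_4(⟨4⟩)` and hence the whole input (U_4): every even
  `e ≥ 2` is a level of `⟨4⟩` at format `4` (`even_mem_pointLevels_unitTensor_four`), of `⟨m⟩` at format `4` inside every
  `m ≥ 4` (`even_mem_pointLevels_four_unitTensor`), and a passing level there (`even_mem_passLevels_four`) — the format-`4`
  column analogue of the format-`2` column `two_mem_pointLevels_unitTensor`.
What (U_4) does NOT yet give: the tower cells `(2, m)` for `12 ≤ m < 16` also need (Ko_4) `3 ∉ emptyLevels m 4` (`k_4(3) > 0`,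
BI 2017 Example 5.6, a Kronecker-coefficient computation not in the tree); `m ≥ 16` is the landed square regime.
No proposition is defined; no `def`; sorry-free; standard axioms.  Nothing here proves `ω = 2` or closes an item.
[cite: BurgisserIkenmeyer2017, eq. (5.5), Thm. 5.13, Prop. 5.22, Problem 5.23, Example 5.6] [cite: BurgisserIkenmeyer2011, §3.2]
-/

noncomputable section

open scoped BigOperators

namespace Summit.MatrixMultiplication.MatrixMultiplication.Theorems.ObstructionCalculus

open Literature.Computability.AlgebraicComplexity (unitTensor actTensor tensorPt fundInvariantTensor latinCubeCount
  aeval_fundInvariantTensor_actTensor fundInvariantTensor_isHomogeneous aeval_fundInvariantTensor_unitTensor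
  latinCubeCount_eq_zero_of_odd latinCubeCount_two latinCubeCount_two_ne_zero)

/-! ## §1  `F_n` is a weight vector of the cube type in this calculus -/

/-- At the full format the rectangular type `((k^N))³` is the constant exponent vector `k`. [bookkeeping] -/
theorem rectType_self (N k : ℕ) (s : Fin 3) : rectType N N k s = fun _ => k :=
  funext fun i => if_pos (Nat.le_add_left N i)

/-- On the Borel subgroup the full-format rectangular character of level `k` is `det^k` (`det` of an upper-triangular matrix is
the product of its diagonal). [cite: BurgisserIkenmeyer2011, §3.2] -/
theorem weightChar_rectType_self {N : ℕ} (k : ℕ) (s : Fin 3) {A : Matrix (Fin N) (Fin N) ℂ} (hA : A ∈ borel N) :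
    weightChar (rectType N N k s) A = A.det ^ k := by
  rw [rectType_self, Matrix.det_of_upperTriangular (fun i j h => hA.1 i j h), ← Finset.prod_pow]
  simp only [weightChar]

/-- The calculus' evaluation `evalT t` is BI 2017's `aeval (tensorPt t)`. [bookkeeping] -/
theorem evalT_eq_aeval_tensorPt {N : ℕ} (t : Tensor ℂ N) (f : MvPolynomial (Idx N) ℂ) :
    evalT t f = MvPolynomial.aeval (tensorPt t) f := rfl

/-- **`F_n` is a weight vector of type `((n^{n²}))³` in degree `n·n²`** on `ℂ^{n²} ⊗ ℂ^{n²} ⊗ ℂ^{n²}`: homogeneous of degree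
`n³` and `F_n((A,B,C)·t) = (det A · det B · det C)^n F_n(t)` for all square `A, B, C` (BI 2017 Thm 5.13, tree
`aeval_fundInvariantTensor_actTensor`), in particular for the Borel subgroup with the character `det^n ⊗ det^n ⊗ det^n =
weightChar ((n^{n²}))³`. [cite: BurgisserIkenmeyer2017, eq. (5.5), Thm. 5.13] -/
theorem fundInvariantTensor_mem_hwvSpace (n : ℕ) :
    fundInvariantTensor n ℂ ∈ hwvSpace (rectType (n * n) (n * n) n) (n * (n * n)) := by
  refine ⟨?_, fun A B C hA hB hC t => ?_⟩
  · have h3 : n ^ 3 = n * (n * n) := by ring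
    exact h3 ▸ fundInvariantTensor_isHomogeneous n ℂ
  · rw [evalT_eq_aeval_tensorPt, evalT_eq_aeval_tensorPt, aeval_fundInvariantTensor_actTensor,
      weightChar_rectType_self n 0 hA, weightChar_rectType_self n 1 hB, weightChar_rectType_self n 2 hC]
    ring

/-! ## §2  Its value at the unit tensor: the Latin-cube count -/

/-- **`F_n(⟨n²⟩) = L(n)`**, the signed Latin-cube count (BI 2017 Prop. 5.22), in the calculus' evaluation.
[cite: BurgisserIkenmeyer2017, Prop. 5.22] -/
theorem evalT_unitTensor_fundInvariantTensor (n : ℕ) :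
    evalT (unitTensor ℂ (n * n)) (fundInvariantTensor n ℂ) = (latinCubeCount n : ℂ) :=
  aeval_fundInvariantTensor_unitTensor n

/-- For odd `n > 1` the fundamental invariant vanishes at `⟨n²⟩` (odd Latin-cube counts cancel, BI 2017 Prop. 5.22) — it does
not certify the level `n` there (and no odd level is a level of a unit tensor, `not_mem_pointLevels_of_odd_level_corner`).
[cite: BurgisserIkenmeyer2017, Prop. 5.22] -/
theorem evalT_unitTensor_fundInvariantTensor_eq_zero_of_odd {n : ℕ} (hn : Odd n) (h1 : 1 < n) :
    evalT (unitTensor ℂ (n * n)) (fundInvariantTensor n ℂ) = 0 := by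
  rw [evalT_unitTensor_fundInvariantTensor, latinCubeCount_eq_zero_of_odd hn h1, Int.cast_zero]

/-- **A non-zero Latin-cube count makes `n` a level of the point `⟨n²⟩`** — the base `e = n` of the window to which
`unitLevels_self_of_prim` reduces the tower input (U_{n²}); for even `n ≥ 6` the non-vanishing is BI 2017 Problem 5.23.
[cite: BurgisserIkenmeyer2017, Prop. 5.22, Problem 5.23] -/
theorem mem_pointLevels_unitTensor_of_latinCubeCount_ne_zero {n : ℕ} (h : latinCubeCount n ≠ 0) :
    n ∈ pointLevels (n * n) (unitTensor ℂ (n * n)) :=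
  ⟨fundInvariantTensor n ℂ, fundInvariantTensor_mem_hwvSpace n, by
    rw [evalT_unitTensor_fundInvariantTensor]
    exact_mod_cast h⟩

/-! ## §3  `n = 2`: `L(2) = 24`, so (U_4) holds unconditionally -/

/-- **`F_2(⟨4⟩) = 24`.** [cite: BurgisserIkenmeyer2017, Prop. 5.22 (`n = 2`)] -/
theorem evalT_unitTensor_fundInvariantTensor_two :
    evalT (unitTensor ℂ (2 * 2)) (fundInvariantTensor 2 ℂ) = 24 := by
  rw [evalT_unitTensor_fundInvariantTensor, latinCubeCount_two]
  norm_num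

/-- **Level `2` is a level of the point `⟨4⟩ ∈ ℂ⁴ ⊗ ℂ⁴ ⊗ ℂ⁴`**, witnessed by `F_2`. [cite: BurgisserIkenmeyer2017, Prop. 5.22] -/
theorem two_mem_pointLevels_unitTensor_four : 2 ∈ pointLevels (2 * 2) (unitTensor ℂ (2 * 2)) :=
  mem_pointLevels_unitTensor_of_latinCubeCount_ne_zero latinCubeCount_two_ne_zero

/-- **(U_4): every even `e ≥ 2` is a level of `⟨4⟩` at format `4`** (base level `2` by `F_2`, then the semigroup/primality
closure `unitLevels_self_of_prim`, whose window at `n = 2` is the single level `e = 2`).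
[cite: BurgisserIkenmeyer2017, Prop. 5.22; BurgisserIkenmeyer2011, Lemma 3.2] -/
theorem even_mem_pointLevels_unitTensor_four (e : ℕ) (he : Even e) (h2 : 2 ≤ e) :
    e ∈ pointLevels (2 * 2) (unitTensor ℂ (2 * 2)) := by
  refine unitLevels_self_of_prim (n := 2) (by norm_num) (fun e' he' hle _ hlt => ?_) e he h2
  have h4 : e' < 2 * 2 := hlt even_two
  obtain ⟨r, hr⟩ := he'
  obtain rfl : e' = 2 := by omega
  exact two_mem_pointLevels_unitTensor_four

/-- **(U_4) at every ambient format `m ≥ 4`**: every even `e ≥ 2` is a level of the point `⟨m⟩` at block format `4` (corner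
law across formats). [this node] -/
theorem even_mem_pointLevels_four_unitTensor {m : ℕ} (hm : 2 * 2 ≤ m) (e : ℕ) (he : Even e) (h2 : 2 ≤ e) :
    e ∈ pointLevels (2 * 2) (unitTensor ℂ m) := by
  obtain ⟨d, rfl⟩ : ∃ d, m = d + 2 * 2 := ⟨m - 2 * 2, by omega⟩
  rw [pointLevels_eq_pointLevels_cornerOf le_rfl d, cornerOf_unitTensor]
  exact even_mem_pointLevels_unitTensor_four e he h2

/-- **… hence every even level `e ≥ 2` PASSES at block format `4` inside every `m ≥ 4`** (a level of the point `⟨4⟩` does not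
vanish on the unit orbit `GL_m³·⟨m⟩`). [this node] -/
theorem even_mem_passLevels_four {m : ℕ} (hm : 2 * 2 ≤ m) (e : ℕ) (he : Even e) (h2 : 2 ≤ e) :
    e ∈ passLevels m (2 * 2) :=
  pointLevels_unitTensor_subset_passLevels hm (even_mem_pointLevels_unitTensor_four e he h2)

end Summit.MatrixMultiplication.MatrixMultiplication.Theorems.ObstructionCalculus

end
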